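import Literature.Computability.AlgebraicComplexity.GKSS19HardnessToHittingSets
import Literature.Computability.AlgebraicComplexity.IMMInVPProofs
import HarnessLib

/-!
# GKSS19, proof of ‹Thm 25›/‹Thm 5›: the base-`B` splitting `Q_{k,d,t}` of a `k`-variate polynomial

Guo–Kumar–Saptharishi–Solomon, *Derandomization from algebraic hardness* (arXiv:1905.00091), proof
of ‹Thm 25› (arXiv p0013.txt:L14-22): "To the polynomial `P_{k,d}(z_1,…,z_k)` in the family, we
associate the natural `kt`-variate polynomial `Q_{k,d,t}((z_{i,j} : i ∈ [k], j ∈ [t]))`, of degree at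
most `d' = (kt)·d^{1/t}`, such that `Q_{k,d,t}` under the substitution `z_{i,j} → z_i^{d^{(j-1)/t}}`
yields the polynomial `P_{k,d}`. This is achieved by replacing each monomial `z_1^{e_1}⋯z_k^{e_k}` in
`P_{k,d}` by `z_{1,*}^{⦅e_1⦆} ⋯ z_{k,*}^{⦅e_k⦆}` where `⦅e_i⦆` is the tuple corresponding to the integer
`e_i` expressed in base `d^{1/t}`. … if `Q_{k,d,t}` has a circuit of size [small] then (by employing
repeated squaring to perform the substitution described above) `P_{k,d}` has a circuit of size at
most [small] `+ O(kt log d)`."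

This file formalizes that construction for an arbitrary base `B` (tree vocabulary: `MvPolynomial`,
fan-in-two size `complexity`):
* `GKSS2019.digit B i e = (e / B^i) % B`, `sum_digit_mul_pow` (base-`B` expansion of `e < B^t`);
* `GKSS2019.splitExp t B e` (the exponent `⦅e⦆` on the `k·t` variables `(v, i) ≃ Fin (k*t)`),
  `GKSS2019.kron t B P` (the polynomial `Q_{k,d,t}`), `GKSS2019.kronSubst t B` (the substitution
  `z_{v,i} ↦ z_v^{B^i}`);
* `bind₁_kronSubst_kron`: the substitution recovers `P` (exponents `< B^t`);
* `totalDegree_kron_le : deg Q ≤ k·t·(B-1)`, `totalDegree_kron_pos`;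
* `aeval_kron`: `Q` evaluated under any algebra map, as a sum over the support of `P` (used by the
  explicit hitting-set machine of ‹Thm 5›);
* `complexity_le_complexity_kron_add`: for `B = 2^β`, `L(P) ≤ L(Q) + k·t·(β·t)` (repeated squaring,
  `complexity_aeval_le`).

Theorem-and-definition file; no named facts.

## References
* [GuoKumarSaptharishiSolomon2019] arXiv:1905.00091, proof of Thm 25 (arXiv p.13, L14-22).
* [Burgisser2000] P. Bürgisser, Completeness and Reduction in Algebraic Complexity Theory, §2.1
  (size calculus `L(f(g)) ≤ L(f) + Σ L(g_i)`, repeated squaring).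
-/

noncomputable section

open MvPolynomial

namespace Literature.Computability.AlgebraicComplexity

namespace GKSS2019

open Literature.Barriers.ValiantsHypothesis

variable {F : Type*} [CommSemiring F] {k : ℕ}

/-! ### Base-`B` digits -/

/-- The `i`-th base-`B` digit of `e`: `(e / B^i) % B`. [cite: GuoKumarSaptharishiSolomon2019, proof of Thm 25 (arXiv p0013.txt:L17 "the integer e_i expressed in base d^{1/t}")] -/
def digit (B i e : ℕ) : ℕ := e / B ^ i % B

/-- Digits are `< B`. [cite: GuoKumarSaptharishiSolomon2019, proof of Thm 25 (arXiv p0013.txt:L17 "expressed in base d^{1/t}")] -/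
theorem digit_lt {B : ℕ} (hB : 0 < B) (i e : ℕ) : digit B i e < B := Nat.mod_lt _ hB

/-- Digits are `≤ B - 1`. [cite: GuoKumarSaptharishiSolomon2019, proof of Thm 25 (arXiv p0013.txt:L17 "expressed in base d^{1/t}")] -/
theorem digit_le_pred (B i e : ℕ) (hB : 0 < B) : digit B i e ≤ B - 1 :=
  Nat.le_sub_one_of_lt (digit_lt hB i e)

/-- The `0`-th digit. [folklore] -/
private theorem digit_zero (B e : ℕ) : digit B 0 e = e % B := by simp [digit]

/-- Digit shift. [folklore] -/
private theorem digit_succ (B i e : ℕ) : digit B (i + 1) e = digit B i (e / B) := by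
  simp [digit, pow_succ', Nat.div_div_eq_div_mul]

/-- Base-`B` expansion: `Σ_{i<t} digit_i(e)·B^i = e` for `e < B^t`. [folklore] -/
private theorem sum_digit_mul_pow (B : ℕ) : ∀ (t e : ℕ), e < B ^ t →
    ∑ i ∈ Finset.range t, digit B i e * B ^ i = e
  | 0, e, he => by simp_all
  | t + 1, e, he => by
    rw [Finset.sum_range_succ', digit_zero, pow_zero, mul_one]
    simp_rw [digit_succ, pow_succ, ← mul_assoc]
    rw [← Finset.sum_mul]
    rcases Nat.eq_zero_or_pos B with rfl | hB
    · simp at he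
    have h' : e / B < B ^ t := by
      rw [Nat.div_lt_iff_lt_mul hB]; simpa [pow_succ] using he
    rw [sum_digit_mul_pow B t (e / B) h']
    exact Nat.div_add_mod' e B

/-! ### The split exponent and the polynomial `Q_{k,d,t}` -/

/-- The variable `z_{v,i}` of `Q_{k,d,t}` as an element of `Fin (k*t)` (`finProdFinEquiv`).
[cite: GuoKumarSaptharishiSolomon2019, proof of Thm 25 (arXiv p0013.txt:L14)] -/
def zv (t : ℕ) (w : Fin (k * t)) : Fin k := (finProdFinEquiv.symm w).1

/-- The block index `i` of the variable `w = z_{v,i}`. [cite: GuoKumarSaptharishiSolomon2019, proof of Thm 25 (arXiv p0013.txt:L14)] -/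
def zi (t : ℕ) (w : Fin (k * t)) : Fin t := (finProdFinEquiv.symm w).2

/-- The exponent `⦅e⦆` of `Q_{k,d,t}`: on `z_{v,i}` the `i`-th base-`B` digit of `e_v`.
[cite: GuoKumarSaptharishiSolomon2019, proof of Thm 25 (arXiv p0013.txt:L16-17)] -/
def splitExp (t B : ℕ) (e : Fin k →₀ ℕ) : Fin (k * t) →₀ ℕ :=
  Finsupp.equivFunOnFinite.symm fun w => digit B (zi t w) (e (zv t w))

/-- Unfolding of `splitExp`. [cite: GuoKumarSaptharishiSolomon2019, proof of Thm 25 (arXiv p0013.txt:L17 "expressed in base d^{1/t}")] -/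
@[simp] theorem splitExp_apply (t B : ℕ) (e : Fin k →₀ ℕ) (w : Fin (k * t)) :
    splitExp t B e w = digit B (zi t w) (e (zv t w)) := by
  simp [splitExp]

/-- **`Q_{k,d,t}`**: each monomial `z^e` of `P` replaced by `z_{*,*}^{⦅e⦆}`, same coefficient.
[cite: GuoKumarSaptharishiSolomon2019, proof of Thm 25 (arXiv p0013.txt:L14-17)] -/
def kron (t B : ℕ) (P : MvPolynomial (Fin k) F) : MvPolynomial (Fin (k * t)) F :=
  ∑ e ∈ P.support, monomial (splitExp t B e) (coeff e P)

/-- **The substitution `z_{v,i} ↦ z_v^{B^i}`.** [cite: GuoKumarSaptharishiSolomon2019, proof of Thm 25 (arXiv p0013.txt:L15 "z_{i,j} → z_i^{d^{(j-1)/t}}")] -/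
def kronSubst (t B : ℕ) : Fin (k * t) → MvPolynomial (Fin k) F :=
  fun w => X (zv t w) ^ B ^ (zi t w : ℕ)

/-- The degree of the split exponent: `|⦅e⦆| ≤ k·t·(B-1)`. [cite: GuoKumarSaptharishiSolomon2019, proof of Thm 25 (arXiv p0013.txt:L14 "of degree at most d' = (kt)·d^{1/t}")] -/
theorem degree_splitExp_le (t B : ℕ) (hB : 0 < B) (e : Fin k →₀ ℕ) :
    (splitExp t B e).degree ≤ k * t * (B - 1) := by
  rw [Finsupp.degree_eq_sum]
  calc ∑ w, splitExp t B e w ≤ ∑ _w : Fin (k * t), (B - 1) :=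
        Finset.sum_le_sum fun w _ => by rw [splitExp_apply]; exact digit_le_pred _ _ _ hB
    _ = k * t * (B - 1) := by simp

/-- `deg Q_{k,d,t} ≤ k·t·(B-1)`. [cite: GuoKumarSaptharishiSolomon2019, proof of Thm 25 (arXiv p0013.txt:L14)] -/
theorem totalDegree_kron_le (t B : ℕ) (hB : 0 < B) (P : MvPolynomial (Fin k) F) :
    (kron t B P).totalDegree ≤ k * t * (B - 1) := by
  classical
  refine (totalDegree_finsetSum _ _).trans (Finset.sup_le fun e _ => ?_)
  refine (totalDegree_monomial_le _ _).trans ?_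
  exact degree_splitExp_le t B hB e

/-- The substitution undoes the splitting on a monomial with exponents `< B^t`. [cite: GuoKumarSaptharishiSolomon2019, proof of Thm 25 (arXiv p0013.txt:L15-16)] -/
theorem bind₁_kronSubst_monomial (t B : ℕ) (e : Fin k →₀ ℕ) (he : ∀ v, e v < B ^ t) (c : F) :
    bind₁ (kronSubst t B) (monomial (splitExp t B e) c) = monomial e c := by
  classical
  rw [bind₁_monomial, monomial_eq]
  congr 1
  -- both products over the full variable types
  rw [Finsupp.prod_of_support_subset _ (Finset.subset_univ _) _ (fun _ _ => pow_zero _)]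
  rw [Finset.prod_subset (Finset.subset_univ (splitExp t B e).support)
    (fun w _ hw => by rw [Finsupp.notMem_support_iff.mp hw, pow_zero])]
  -- reindex `Fin (k*t)` by `Fin k × Fin t`
  rw [← Fintype.prod_equiv finProdFinEquiv (fun p : Fin k × Fin t =>
      (X p.1 : MvPolynomial (Fin k) F) ^ (B ^ (p.2 : ℕ) * digit B p.2 (e p.1))) _
      (fun p => by simp [kronSubst, zv, zi, pow_mul])]
  rw [Fintype.prod_prod_type]
  refine Finset.prod_congr rfl fun v _ => ?_
  dsimp only
  rw [Finset.prod_pow_eq_pow_sum, Fin.sum_univ_eq_sum_range (fun i => B ^ i * digit B i (e v)) t]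
  simp_rw [mul_comm (B ^ _)]
  rw [sum_digit_mul_pow B t (e v) (he v)]

/-- **`Q_{k,d,t}(z_{v,i} ↦ z_v^{B^i}) = P`** when all exponents of `P` are `< B^t`.
[cite: GuoKumarSaptharishiSolomon2019, proof of Thm 25 (arXiv p0013.txt:L14-16)] -/
theorem bind₁_kronSubst_kron (t B : ℕ) (P : MvPolynomial (Fin k) F)
    (hP : ∀ e ∈ P.support, ∀ v, e v < B ^ t) : bind₁ (kronSubst t B) (kron t B P) = P := by
  classical
  rw [kron, map_sum]
  conv_rhs => rw [P.as_sum]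
  exact Finset.sum_congr rfl fun e he => bind₁_kronSubst_monomial t B e (hP e he) _

/-- Exponents of a polynomial of total degree `< B^t` are `< B^t`. [folklore] -/
private theorem exp_lt_of_totalDegree_lt {P : MvPolynomial (Fin k) F} {N : ℕ} (hP : P.totalDegree < N)
    (e : Fin k →₀ ℕ) (he : e ∈ P.support) (v : Fin k) : e v < N :=
  ((Finsupp.le_degree v e).trans (le_totalDegree he)).trans_lt hP

/-- `Q_{k,d,t}` is non-constant when `P` is. [cite: GuoKumarSaptharishiSolomon2019, proof of Thm 25 (arXiv p0013.txt:L22 "a k-variate polynomial of degree d′")] -/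
theorem totalDegree_kron_pos (t B : ℕ) (P : MvPolynomial (Fin k) F) (hP : P.totalDegree < B ^ t)
    (hpos : 0 < P.totalDegree) : 0 < (kron t B P).totalDegree := by
  by_contra h
  have h0 : (kron t B P).totalDegree = 0 := by omega
  have ha : kron t B P = C (coeff 0 (kron t B P)) := totalDegree_eq_zero_iff_eq_C.mp h0
  have hP' := bind₁_kronSubst_kron t B P (fun e he v => exp_lt_of_totalDegree_lt hP e he v)
  rw [ha, bind₁_C_right] at hP'
  rw [← hP', totalDegree_C] at hpos
  exact lt_irrefl 0 hpos

/-- **`Q_{k,d,t}` under an algebra map**, monomial by monomial of `P`: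
`aeval f Q = Σ_{e ∈ supp P} coeff_e(P) · Π_w f(w)^{⦅e⦆_w}`. [cite: GuoKumarSaptharishiSolomon2019, proof of Thm 25 (arXiv p0013.txt:L16-17)] -/
theorem aeval_kron {A : Type*} [CommSemiring A] [Algebra F A] (t B : ℕ) (P : MvPolynomial (Fin k) F)
    (f : Fin (k * t) → A) :
    aeval f (kron t B P) = ∑ e ∈ P.support, algebraMap F A (coeff e P) * ∏ w, f w ^ splitExp t B e w := by
  classical
  rw [kron, map_sum]
  refine Finset.sum_congr rfl fun e _ => ?_
  rw [aeval_monomial, Finsupp.prod_of_support_subset _ (Finset.subset_univ _) _ (fun _ _ => pow_zero _)]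

/-! ### Hardness transfer: `L(P) ≤ L(Q) + k·t·(β t)` for `B = 2^β` -/

section Complexity

variable {K : Type*} [Field K]

/-- Repeated squaring: `L(x_v^{2^j}) ≤ j`. [cite: Burgisser2000, §2.1] -/
private theorem complexity_X_pow_two_pow_le (v : Fin k) (j : ℕ) :
    complexity ((X v : MvPolynomial (Fin k) K) ^ 2 ^ j) ≤ j := by
  induction j with
  | zero => simp [complexity_X_holds (k := K) v]
  | succ j ih =>
    have h := complexity_aeval_le (X () * X () : MvPolynomial Unit K)
      (fun _ => (X v : MvPolynomial (Fin k) K) ^ 2 ^ j)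
    rw [map_mul, aeval_X, ← pow_two, ← pow_mul, ← pow_succ] at h
    have h1 := complexity_mul_le_holds (X () : MvPolynomial Unit K) (X ())
    have h2 := complexity_X_holds (k := K) (σ := Unit) ()
    rw [Fintype.sum_unique] at h
    omega

/-- **Hardness transfer** ("by employing repeated squaring to perform the substitution …
`P_{k,d}` has a circuit of size at most [that of `Q`] `+ O(kt log d)`"): for the base `B = 2^β`,
`L(P) ≤ L(Q_{k,d,t}) + k·t·(β·t)`. [cite: GuoKumarSaptharishiSolomon2019, proof of Thm 25 (arXiv p0013.txt:L18-21)] -/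
theorem complexity_le_complexity_kron_add (t β : ℕ) (P : MvPolynomial (Fin k) K)
    (hP : P.totalDegree < (2 ^ β) ^ t) :
    complexity P ≤ complexity (kron t (2 ^ β) P) + k * t * (β * t) := by
  classical
  have hP' := bind₁_kronSubst_kron t (2 ^ β) P (fun e he v => exp_lt_of_totalDegree_lt hP e he v)
  have h := complexity_aeval_le (kron t (2 ^ β) P) (kronSubst (k := k) (F := K) t (2 ^ β))
  rw [← aeval_eq_bind₁ (kronSubst t (2 ^ β))] at hP'
  rw [hP'] at h
  refine h.trans (Nat.add_le_add_left ?_ _)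
  calc ∑ w, complexity (kronSubst (k := k) (F := K) t (2 ^ β) w)
      ≤ ∑ _w : Fin (k * t), β * t := Finset.sum_le_sum fun w _ => by
        unfold kronSubst
        rw [← pow_mul]
        exact (complexity_X_pow_two_pow_le _ _).trans
          (Nat.mul_le_mul_left _ (zi t w).isLt.le)
    _ = k * t * (β * t) := by simp

end Complexity

end GKSS2019

end Literature.Computability.AlgebraicComplexity

end
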